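/-
Copyright: the b2b-balaban cell (near-miss cell 7), T⁴-continuum fan-out, lineage t4-ne7b-p3 (node U5c LARGE-DEVIATION
member P3).  Released under the licence of the surrounding project.
-/
import Summits.QuantumFields.BalabanUV.T4Continuum.Support.SpaceTimeRealisedLin
import Summits.QuantumFields.BalabanUV.T4Continuum.Support.SpaceTimeLevels
import Summits.QuantumFields.BalabanUV.T4Continuum.Support.HistoryLevelsFlow

/-!
# Space-time Peierls ∕ Cramér route for NE7b — THE LINEAGE READINGS ON THE COUNT CARRIER ALONG THE TYPED FLOW: the
# level hypotheses (vii) are discharged by the model scale `levelOf`, and — for the window exponents `expOf L R` of a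
# run obeying (2.5) — by the typed flow facts themselves

Summits-side support leaf of the T⁴-continuum cell (rung (B)+1 on a FINITE torus only; NOT infinite volume, NOT the
mass gap, NOT the Clay statement; NOT a proof of the spine estimate NE7b).  Lineage `t4-ne7b-p3` (generation 3), node
U5c, skeleton `t4/skeletons/NE7b-t4-ne7b-p3.md` §12.  [folklore] plumbing over this lineage's `SpaceTimeRealisedLin`
(`RLin.lineageReadings`, `RLin.runReadingsFlow`) and `SpaceTimeLevels` (`extExp`, `dropCtl_extExp`, `levelOf_mono'`,
`levelOf_jump`, `ratio_extExp_eq`), and the COUNT swarm's `HistoryLevelsFlow` (`expOf`, `expOf_succ_le`,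
`dropCtl_expOf` = `Lit.B16SProfile.dropCtl_of_27b` read on the exponents) — all BY NAME; nothing printed is asserted;
no `[cite:]` tag.

WHAT.  For realised lineage data `D : RLin d n L K K (levelOf s K) ι Λ` whose flow exponents are the window exponents
frozen beyond the cutoff (`D.s = extExp s K`; the torus exponent is `Kx = K`, the levels are the COUNT swarm's model
scale `levelOf s K`):
* §1 **`RLin.lineageReadings_levels`**: the five level hypotheses of `RLin.lineageReadings` (`ℓ` monotone, jumps `≤ 2`,
  `ratio L s u = L^{ℓ(u+1)−ℓ u}`, drop control on every horizon — and `hℓK` inside `D`) are replaced by the TWO typed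
  flow facts `∀ t < K, s (t+1) ≤ s t` and `DropCtl s K`; **`RLin.runReadingsFlow_levels`**: the same for the binder of
  the flow end.
* §2 **`RLin.runReadingsFlow_typed`**: with `s := expOf L R` (the exponents of the sizes `R` obeying (2.5),
  `HistoryLevelsFlow.expOf`), those two facts are themselves DERIVED from the run's typed flow facts — (2.5) `IsRj` at
  every step `≤ Kc`, the interval `0 < g ≤ γ ≤ 1` with monotone couplings, (2.7) at the size exponent `r`, and the
  located smallness `(1 + g_n²β′(n−m))^{β₀} ≤ L^{⌊max(n−m,2)∕2⌋}` of the drop control (`dropCtl_expOf`) — so the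
  binder `RunReadingsFlow` of `SpaceTimeAssembly.exists_irThreshold_relWeightBound` is inhabited from: the realised
  lineage data, readings (i) (ii′) (iii′) (iv′) (v′) (vi) of `RLin.lineageReadings`, and TYPED FLOW FACTS ONLY.
LOCATED (not hidden): the identification (iv′) is stated along the frozen exponents `extExp s K`, which agree with
the run's exponents on `[0, K]` — the only steps a history pending at `K` involves; run B of the node (cutoff
`Kc = K + 1`) is read at the freeze point `K` with its components pending at step `K` (I-3), `Kc` entering only the
consistency and the flow facts.

HONEST DEPENDENCY (cell, verbatim): continuum YM on T⁴ ⇐ BetaPertH ∧ nine spine estimates (0/9 proved); BetaPertH ⇐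
(D1) ∧ (D4) ∧ CAP+tail; G-an2-4 gates asym, D1 and NE2/3/4.  This file changes none of it.
-/

open Finset

namespace Summit.QuantumFields.BalabanUV.T4Continuum.SpaceTimePeierls

open Literature.MathematicalPhysics.QuantumFieldTheory.Balaban1983to89
open Literature.MathematicalPhysics.QuantumFieldTheory.Balaban1983to89.B13ScaleTransfer
open Literature.MathematicalPhysics.QuantumFieldTheory.Balaban1983to89.B16SProfile
open T4PersistenceDictionary T4BankedInduction T4PrintedShapeBanking
open Summit.QuantumFields.BalabanUV.T4Continuum.ZoneTorus
open Summit.QuantumFields.BalabanUV.T4Continuum.HistoryZones (levelOf expOf expOf_succ_le dropCtl_expOf)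
open Summit.QuantumFields.BalabanUV.T4Continuum.HistoryAdmissible
open Summit.QuantumFields.BalabanUV.T4Continuum.HistoryRealise
open SpaceTimePeierlsLeaves

noncomputable section

open Classical

namespace RLin

variable {d n L K : ℕ} {ι Λ : Type*} [DecidableEq Λ] {s : ℕ → ℕ} (D : RLin d n L K K (levelOf s K) ι Λ)

/-! ## §1 The level hypotheses from two typed flow facts -/

/-- **THE LINEAGE READINGS ON THE COUNT CARRIER ALONG A DROP-CONTROLLED FLOW.**  As `RLin.lineageReadings`, with the
levels the model scale `levelOf s K`, the torus exponent `K`, the flow exponents `extExp s K`, and the level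
hypotheses replaced by `s` stepwise non-increasing on `[0, K]` and `DropCtl s K`. [folklore] -/
theorem lineageReadings_levels {C : T4PrintedShapeBanking.Consts} {Kc : ℕ} {R : ℕ → ℕ} {g : ℕ → ℝ} {A : ι → ℝ}
    {Bad : Finset ι} {jlo : ℕ} {nup c₃ : ℝ} {rest : Finset (STCellV d n L K K (levelOf s K)) → ι → ℝ}
    (hDs : D.s = extExp s K) (hs : ∀ t, t < K → s (t + 1) ≤ s t) (hdropK : DropCtl s K)
    (hn : 0 < n) (hL : 4 ≤ L) (hR : ∀ t, 1 ≤ R t) (hn₁ : 13 ≤ C.n₁) (hKc : K ≤ Kc)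
    (hnonneg : ∀ τ ∈ D.T, 0 ≤ A τ) (hBad : Bad ⊆ D.T) (hjlo : jlo ≤ K)
    (hold : ∀ τ ∈ Bad, ∃ lam ∈ D.fam τ, (D.P lam).rootStep ≤ jlo)
    (hsep : D.LatSep)
    (hreal : ∀ τ ∈ D.T, ∀ lam ∈ D.fam τ, Realises L D.s R (D.P lam) (D.Z lam) ∧
      PendingAt L D.s R (D.P lam).lastStep (D.Z lam) K ∧ (D.P lam).TypeNodup ∧
      (D.P lam).RenewAtReach (dictW R C.n₁))
    (hfac : ∀ (𝒦 : Finset (STCellV d n L K K (levelOf s K))), ∀ τ ∈ D.T, D.toLinData.model.IsContour τ 𝒦 →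
      ∀ lam ∈ D.fam τ, (∀ c ∈ 𝒦, D.toLinData.InLin lam c) →
        A τ ≤ Real.exp (-(credits (credit C g) (D.P lam).toGen -
          lifeCost (dictW R C.n₁) (cost C Kc R) (D.P lam).toGen)) * rest 𝒦 τ)
    (hrest0 : ∀ (𝒦 : Finset (STCellV d n L K K (levelOf s K))), ∀ τ ∈ D.T, 0 ≤ rest 𝒦 τ)
    (hrest : ∀ (𝒦 : Finset (STCellV d n L K K (levelOf s K))),
      ∑ τ ∈ D.toLinData.model.T.filter (fun τ => D.toLinData.model.IsContour τ 𝒦), rest 𝒦 τ ≤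
        Real.exp c₃ ^ 𝒦.card * nup) :
    LineageReadings D.toLinData.model C K Kc R g A Bad jlo nup (3 ^ d + L ^ (2 * d) + 1)
      ((((3 ^ d + L ^ (2 * d) + 1 : ℕ) : ℝ) + 1) ^ 2) (((n * L ^ (K - levelOf s K K)) ^ d : ℕ) : ℝ)
      (8 * 126 ^ d) (126 ^ d) ((127 : ℝ) ^ d + 3) c₃ :=
  D.lineageReadings hn hL (levelOf_mono' hs hdropK) (levelOf_jump hs hdropK)
    (fun u => by rw [hDs]; exact ratio_extExp_eq hs hdropK L u) (fun m => by rw [hDs]; exact dropCtl_extExp hdropK m)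
    hR hn₁ hKc hnonneg hBad hjlo hold hsep hreal hfac hrest0 hrest

/-- **`RunReadingsFlow` ALONG A DROP-CONTROLLED FLOW**: the binder of the flow end from the realised lineage data, the
readings, the run's typed flow facts with the infrared value, and the two level facts. [folklore] -/
theorem runReadingsFlow_levels {C : T4PrintedShapeBanking.Consts} {r : ℕ} {β₀ x₀ β' : ℝ} {T : ℕ → Finset ι}
    {X : ℕ → ℝ → ι → ℝ} {Bad : ℕ → ℝ → Finset ι} {xup : ℕ → ℝ → ℝ} {jstar : ℕ → ℕ} {c₃ : ℝ} {t : ℝ}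
    {Kc : ℕ} {R : ℕ → ℕ} {g : ℕ → ℝ} {rest : Finset (STCellV d n L K K (levelOf s K)) → ι → ℝ}
    (hT : D.T = T K) (hDs : D.s = extExp s K) (hs : ∀ t, t < K → s (t + 1) ≤ s t) (hdropK : DropCtl s K)
    (h27 : B14.FlowIneq27 g β' β₀ C.p₀ Kc) (h29 : B14FlowStep.FlowIneq29 R g L β' β₀ Kc)
    (hRj : ∀ u, u ≤ Kc → B14.IsRj L r (g u) (R u)) (hx1 : ∀ u, u ≤ Kc → 1 ≤ Real.log ((g u) ^ 2)⁻¹)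
    (hxK : x₀ ≤ Real.log ((g Kc) ^ 2)⁻¹)
    (hn : 0 < n) (hL : 4 ≤ L) (hR : ∀ t, 1 ≤ R t) (hn₁ : 13 ≤ C.n₁) (hKc : K ≤ Kc)
    (hnonneg : ∀ τ ∈ D.T, 0 ≤ X K t τ) (hBad : Bad K t ⊆ D.T) (hjlo : jstar K ≤ K)
    (hold : ∀ τ ∈ Bad K t, ∃ lam ∈ D.fam τ, (D.P lam).rootStep ≤ jstar K)
    (hsep : D.LatSep)
    (hreal : ∀ τ ∈ D.T, ∀ lam ∈ D.fam τ, Realises L D.s R (D.P lam) (D.Z lam) ∧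
      PendingAt L D.s R (D.P lam).lastStep (D.Z lam) K ∧ (D.P lam).TypeNodup ∧
      (D.P lam).RenewAtReach (dictW R C.n₁))
    (hfac : ∀ (𝒦 : Finset (STCellV d n L K K (levelOf s K))), ∀ τ ∈ D.T, D.toLinData.model.IsContour τ 𝒦 →
      ∀ lam ∈ D.fam τ, (∀ c ∈ 𝒦, D.toLinData.InLin lam c) →
        X K t τ ≤ Real.exp (-(credits (credit C g) (D.P lam).toGen -
          lifeCost (dictW R C.n₁) (cost C Kc R) (D.P lam).toGen)) * rest 𝒦 τ)
    (hrest0 : ∀ (𝒦 : Finset (STCellV d n L K K (levelOf s K))), ∀ τ ∈ D.T, 0 ≤ rest 𝒦 τ)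
    (hrest : ∀ (𝒦 : Finset (STCellV d n L K K (levelOf s K))),
      ∑ τ ∈ D.toLinData.model.T.filter (fun τ => D.toLinData.model.IsContour τ 𝒦), rest 𝒦 τ ≤
        Real.exp c₃ ^ 𝒦.card * xup K t) :
    RunReadingsFlow C L r β₀ x₀ T X Bad xup jstar ((((3 ^ d + L ^ (2 * d) + 1 : ℕ) : ℝ) + 1) ^ 2)
      (((n * L ^ (K - levelOf s K K)) ^ d : ℕ) : ℝ) (8 * 126 ^ d) (126 ^ d) ((127 : ℝ) ^ d + 3) c₃ K t :=
  D.runReadingsFlow hT h27 h29 hRj hx1 hxK hn hL (levelOf_mono' hs hdropK) (levelOf_jump hs hdropK)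
    (fun u => by rw [hDs]; exact ratio_extExp_eq hs hdropK L u) (fun m => by rw [hDs]; exact dropCtl_extExp hdropK m)
    hR hn₁ hKc hnonneg hBad hjlo hold hsep hreal hfac hrest0 hrest

end RLin

/-! ## §2 The two level facts from the typed flow: window exponents `expOf L R` -/

namespace RLin

variable {d n L K : ℕ} {ι Λ : Type*} [DecidableEq Λ] {R : ℕ → ℕ}
  (D : RLin d n L K K (levelOf (expOf L R) K) ι Λ)

/-- **`RunReadingsFlow` FROM THE REALISED DATA, THE READINGS AND TYPED FLOW FACTS ONLY.**  With the window exponents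
`s := expOf L R` of sizes obeying (2.5) at every step `≤ Kc` (`K ≤ Kc`), the two level facts of §1 follow from the
interval `0 < g ≤ γ ≤ 1` with monotone couplings (`expOf_succ_le`) and from (2.7) at the size exponent `r` plus the
located smallness of the drop control (`dropCtl_expOf`); the remaining hypotheses are those of
`RLin.runReadingsFlow_levels`. [folklore] -/
theorem runReadingsFlow_typed {C : T4PrintedShapeBanking.Consts} {r : ℕ} {γ β₀ x₀ β' : ℝ} {T : ℕ → Finset ι}
    {X : ℕ → ℝ → ι → ℝ} {Bad : ℕ → ℝ → Finset ι} {xup : ℕ → ℝ → ℝ} {jstar : ℕ → ℕ} {c₃ : ℝ} {t : ℝ}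
    {Kc : ℕ} {g : ℕ → ℝ} {rest : Finset (STCellV d n L K K (levelOf (expOf L R) K)) → ι → ℝ}
    (hT : D.T = T K) (hDs : D.s = extExp (expOf L R) K)
    -- the typed flow facts of the run
    (hI : Step.InInterval γ Kc g) (hγ1 : γ ≤ 1) (hgmono : ∀ u, u < Kc → g u ≤ g (u + 1))
    (h27 : B14.FlowIneq27 g β' β₀ C.p₀ Kc) (h27r : B14.FlowIneq27 g β' β₀ r Kc)
    (h29 : B14FlowStep.FlowIneq29 R g L β' β₀ Kc) (hRj : ∀ u, u ≤ Kc → B14.IsRj L r (g u) (R u))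
    (hΘ : ∀ m u, m < u → u ≤ Kc → (1 + (g u) ^ 2 * β' * ((u : ℝ) - m)) ^ β₀ ≤ (L : ℝ) ^ (max (u - m) 2 / 2))
    (hx1 : ∀ u, u ≤ Kc → 1 ≤ Real.log ((g u) ^ 2)⁻¹) (hxK : x₀ ≤ Real.log ((g Kc) ^ 2)⁻¹)
    -- the remaining hypotheses of `RLin.lineageReadings`
    (hn : 0 < n) (hL : 4 ≤ L) (hR : ∀ t, 1 ≤ R t) (hn₁ : 13 ≤ C.n₁) (hKc : K ≤ Kc)
    (hnonneg : ∀ τ ∈ D.T, 0 ≤ X K t τ) (hBad : Bad K t ⊆ D.T) (hjlo : jstar K ≤ K)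
    (hold : ∀ τ ∈ Bad K t, ∃ lam ∈ D.fam τ, (D.P lam).rootStep ≤ jstar K)
    (hsep : D.LatSep)
    (hreal : ∀ τ ∈ D.T, ∀ lam ∈ D.fam τ, Realises L D.s R (D.P lam) (D.Z lam) ∧
      PendingAt L D.s R (D.P lam).lastStep (D.Z lam) K ∧ (D.P lam).TypeNodup ∧
      (D.P lam).RenewAtReach (dictW R C.n₁))
    (hfac : ∀ (𝒦 : Finset (STCellV d n L K K (levelOf (expOf L R) K))), ∀ τ ∈ D.T,
      D.toLinData.model.IsContour τ 𝒦 → ∀ lam ∈ D.fam τ, (∀ c ∈ 𝒦, D.toLinData.InLin lam c) →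
        X K t τ ≤ Real.exp (-(credits (credit C g) (D.P lam).toGen -
          lifeCost (dictW R C.n₁) (cost C Kc R) (D.P lam).toGen)) * rest 𝒦 τ)
    (hrest0 : ∀ (𝒦 : Finset (STCellV d n L K K (levelOf (expOf L R) K))), ∀ τ ∈ D.T, 0 ≤ rest 𝒦 τ)
    (hrest : ∀ (𝒦 : Finset (STCellV d n L K K (levelOf (expOf L R) K))),
      ∑ τ ∈ D.toLinData.model.T.filter (fun τ => D.toLinData.model.IsContour τ 𝒦), rest 𝒦 τ ≤
        Real.exp c₃ ^ 𝒦.card * xup K t) :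
    RunReadingsFlow C L r β₀ x₀ T X Bad xup jstar ((((3 ^ d + L ^ (2 * d) + 1 : ℕ) : ℝ) + 1) ^ 2)
      (((n * L ^ (K - levelOf (expOf L R) K K)) ^ d : ℕ) : ℝ) (8 * 126 ^ d) (126 ^ d) ((127 : ℝ) ^ d + 3)
      c₃ K t := by
  have hL2 : 2 ≤ L := by omega
  -- the two level facts at the run's horizon `Kc`, restricted to `K`
  have hsKc : ∀ u, u < Kc → expOf L R (u + 1) ≤ expOf L R u :=
    expOf_succ_le hL2 hRj (fun u hu => (hI u hu).1) (fun u hu => (hI u hu).2.trans hγ1) hgmono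
  have hdropKc : DropCtl (expOf L R) Kc := dropCtl_expOf hL2 hI hγ1 hRj h27r hΘ
  have hs : ∀ u, u < K → expOf L R (u + 1) ≤ expOf L R u := fun u hu => hsKc u (lt_of_lt_of_le hu hKc)
  have hdropK : DropCtl (expOf L R) K := fun i k hik hk => hdropKc i k hik (hk.trans hKc)
  exact D.runReadingsFlow_levels hT hDs hs hdropK h27 h29 hRj hx1 hxK hn hL hR hn₁ hKc hnonneg hBad hjlo hold hsep
    hreal hfac hrest0 hrest

end RLin

end

end Summit.QuantumFields.BalabanUV.T4Continuum.SpaceTimePeierls
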